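import Summits.BirchSwinnertonDyer.BirchSwinnertonDyer.Theorems.AdditiveKolyvaginRoadKolyvaginJump
import Summits.BirchSwinnertonDyer.BirchSwinnertonDyer.Theorems.AdditiveKolyvaginRoadToricFrobenius
import Summits.BirchSwinnertonDyer.BirchSwinnertonDyer.Theorems.AdditiveKolyvaginRoadLocalDictionaries
import Literature.NumberTheory.EllipticCurves.CasselsTateLocalCupSymmetry
import HarnessLib

/-!
# Route `AdditiveKolyvaginRoad`, crux `LevelKolyvaginSystemsAdditive` (item stmt-BirchSwinnertonDyer-21396, KS′):
# the HYPERBOLIC PLANE at a Bertolini–Darmon admissible place — an isotropic class is Kummer or toric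
# (step 2 of (R) ONE-PRIME RAISING, R-ROADMAP on 21396)
# (cell `pub/bsd-wall`, lead prover `bsd-wall-akr-p2x` g0, line `birth`; `--supports stmt-BirchSwinnertonDyer-21396`, helper)

WHAT. At the place `w` above an admissible `q`, `H¹(K_w, E[p])` has order `p²` (Tate's local Euler characteristic,
`natCard_galoisCohomology_one_torsion_eq_sq`, with `#E[p]^{Γ_{K_w}} = p`, akr-p1 g3/g4) and carries the symmetric
(`cupProduct_comm_of_skew`, p570231) perfect pairing `b_w = inv_w(· ∪ₑ ·)` (`KummerPT.invWeilPairing_flip_bijective`),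
for which E's Kummer condition `F` and the toric condition `O` are Lagrangian (`annRight = itself`: X11b
`KummerDuality.annRight_invWeilPairing_kummerSelmerStructure_eq`, akr-p1 `annRight_invWeilPairing_eq_of_isotropic_of_card_le`),
hence lines of order `p`; they are DISTINCT as soon as some global class is Kummer but not locally trivial at `w`
(Bertolini–Darmon Lemma 2.6, akr-p1's `ToricFrob.selmerLocalKer_inf_toricLocalKer_le_torsionLocalKer`). So
`H¹(K_w, E[p]) = F ⊕ O` is a HYPERBOLIC PLANE and its isotropic vectors lie on `F ∪ O`:
`mem_selmerLocalKer_or_mem_toricLocalKer_of_isotropic` — a global class `g` with `b_w(loc g, loc g) = 0` is Kummer at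
`w` or toric at `w`. This is the local heart of the rank-RAISING half of W. Zhang 2014 Lemma 5.3 ∕ Gross–Parson at an
admissible prime (the relaxed Selmer line, isotropic by Poitou–Tate reciprocity, is the toric line once it is not the
Kummer line).

HONEST FRAMING: theorems only; 0 definitions, 0 named facts, 0 `sorry`; hypotheses = a Weil pairing, a Poitou–Tate
family `inv` with `IsPerfect` (both supplied by the named PT fact ∕ `exists_weilPairing_holds` at the call site); closes
nothing. BSD is not proved by any of this.

References: [cite: BertoliniDarmon2005, §2.2–§2.3, Lemma 2.6] [cite: WZhang2014, Lemma 5.1, Lemma 5.3]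
[cite: MilneADT2006, Ch. I, Cor. 2.3, Thm. 2.8] [cite: PoonenRains2012, Prop. 4.10]
[cite: NeukirchSchmidtWingberg2008, I §4 Prop. 1.4.4].
-/

-- single-conjunct summit: `Summit.BirchSwinnertonDyer.BirchSwinnertonDyer.…` repeats the name by design
set_option linter.dupNamespace false

noncomputable section

open scoped Classical NumberField
open Function NumberField IsDedekindDomain Field WeierstrassCurve
open Literature.NumberTheory.EllipticCurves Literature.NumberTheory.EllipticCurves.ModularForms
open Literature.NumberTheory.GaloisRepresentations Literature.NumberTheory.GaloisRepresentations.DiscreteGaloisModule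
  Literature.NumberTheory.GaloisCohomology
open Summit.BirchSwinnertonDyer.Rank1Residual.X11b.FiniteDuality
open Summit.BirchSwinnertonDyer.Rank1Residual.X11b.Relaxation
open Summit.BirchSwinnertonDyer.Rank1Residual.X11b
open Summit.BirchSwinnertonDyer.Rank1Residual.GaloisImage
open Summit.BirchSwinnertonDyer.Rank1Residual.X11b.Three.Koly.Method2

namespace Summit.BirchSwinnertonDyer.BirchSwinnertonDyer.Theorems.AdditiveKoly

/-! ## §1 Two finite-group lemmas and the skewness of an alternating pairing -/

/-- An alternating biadditive pairing is skew: `B x y = -B y x`. [folklore] -/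
theorem skew_of_alternating' {M N : Type*} [AddCommGroup M] [AddCommGroup N] (B : M →+ M →+ N)
    (halt : ∀ x, B x x = 0) (x y : M) : B x y = -B y x := by
  have h := halt (x + y)
  simp only [map_add, AddMonoidHom.add_apply, halt, zero_add, add_zero] at h
  rw [add_comm] at h
  exact eq_neg_of_add_eq_zero_left h

/-- In a group of prime order every non-zero element generates. [folklore] -/
theorem zmultiples_eq_of_card_prime {A : Type*} [AddCommGroup A] (F : AddSubgroup A) {p : ℕ} (hp : p.Prime)
    (hF : Nat.card F = p) {f : A} (hf : f ∈ F) (hf0 : f ≠ 0) : AddSubgroup.zmultiples f = F := by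
  have hle : AddSubgroup.zmultiples f ≤ F := (AddSubgroup.zmultiples_le).mpr hf
  haveI : Finite F := Nat.finite_of_card_ne_zero (by rw [hF]; exact hp.ne_zero)
  have hdvd : Nat.card (AddSubgroup.zmultiples f) ∣ p := hF ▸ AddSubgroup.card_dvd_of_le hle
  rcases (Nat.dvd_prime hp).mp hdvd with h1 | hpc
  · exfalso
    haveI : Finite (AddSubgroup.zmultiples f) := Finite.of_injective _ (AddSubgroup.inclusion_injective hle)
    have hsub : (⟨f, AddSubgroup.mem_zmultiples f⟩ : AddSubgroup.zmultiples f) = 0 :=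
      Subsingleton.elim (h := (Nat.card_eq_one_iff_unique.mp h1).1) _ _
    exact hf0 (congrArg Subtype.val hsub)
  · exact AddSubgroup.eq_of_le_of_card_ge hle (by rw [hF, hpc])

/-! ## §2 The hyperbolic plane at an admissible place -/

variable (W : WeierstrassCurve ℚ) (K : Type) [Field K] [NumberField K] (p : ℕ) [W.IsElliptic] [W.IsGloballyMinimal]
  [Fact p.Prime]
  -- cup products need the compactness of the local absolute Galois groups (binder, discharged by
  -- `absoluteGaloisGroup_compactSpace` at the call site)
  [∀ v : Place K, CompactSpace (absoluteGaloisGroup (Place.Completion v))]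

omit [W.IsElliptic] [W.IsGloballyMinimal] in
/-- **The local Weil cup-product pairing `inv_w(· ∪ₑ ·)` is symmetric at every finite place** (graded commutativity in
bidegree `(1,1)` for the skew Weil pairing, `cupProduct_comm_of_skew`). [cite: NeukirchSchmidtWingberg2008, I §4
Prop. 1.4.4] -/
theorem invWeilPairing_comm
    (e : geomTorsion (W.baseChange K) ((p ^ 1 : ℕ) : ℤ) → geomTorsion (W.baseChange K) ((p ^ 1 : ℕ) : ℤ) →
      AlgebraicClosure K)
    (hμ : ∀ P Q, e P Q ^ (p ^ 1) = 1) (hadd₁ : ∀ P₁ P₂ Q, e (P₁ + P₂) Q = e P₁ Q * e P₂ Q)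
    (hadd₂ : ∀ P Q₁ Q₂, e P (Q₁ + Q₂) = e P Q₁ * e P Q₂) (halt : ∀ Q, e Q Q = 1)
    (hgal : ∀ (σ : absoluteGaloisGroup K) (P Q : geomTorsion (W.baseChange K) ((p ^ 1 : ℕ) : ℤ)),
      σ • e P Q = e (σ • P) (σ • Q))
    (inv : LocalInvariants K (p ^ 1)) (v : Place K)
    (a b : galoisCohomology (((W.baseChange K).torsionGaloisModule ((p ^ 1 : ℕ) : ℤ)).toLocal v) 1) :
    invWeilPairing (W.baseChange K) (p ^ 1) e hμ hadd₁ hadd₂ hgal inv v a b =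
      invWeilPairing (W.baseChange K) (p ^ 1) e hμ hadd₁ hadd₂ hgal inv v b a := by
  have hp : p.Prime := Fact.out
  haveI : NeZero (p ^ 1 : ℕ) := ⟨pow_ne_zero 1 hp.ne_zero⟩
  rw [invWeilPairing_apply, invWeilPairing_apply]
  congr 1
  refine cupProduct_comm_of_skew _ (fun S T ↦ ?_) a b
  rw [weilContPairingLocal_toLin_apply, weilContPairingLocal_toLin_apply]
  exact skew_of_alternating' _ (weilPairingHom_self (W.baseChange K) (p ^ 1) e hμ hadd₁ hadd₂ halt) S T

/-- **An ISOTROPIC class at an admissible place is KUMMER or TORIC there.** `K` imaginary quadratic; `q` a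
Bertolini–Darmon admissible prime with place `w ∋ q`; a Weil pairing `e` on `E[p]` and a Poitou–Tate family `inv` with
`IsPerfect`; a global class `x` which is Kummer at `w` and NOT locally trivial at `w` (it certifies that the Kummer line
and the toric line of `H¹(K_w, E[p])` are distinct, Bertolini–Darmon Lemma 2.6). Then every global class `g` whose
localisation is isotropic, `inv_w(loc g ∪ₑ loc g) = 0`, satisfies E's Kummer condition at `w` or the toric condition at
`w`. Proof: `H¹(K_w, E[p]) = F ⊕ O` (orders `p², p, p`; `F = F^⊥`, `O = O^⊥`, `F ∩ O = 0`), `loc g = f + o`,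
`0 = b(f+o, f+o) = 2 b(f, o)` by isotropy of `F`, `O` and SYMMETRY, so `b(f, o) = 0` (`p` odd); if `f ≠ 0` it generates
`F`, so `o ∈ F^⊥ = F`, `o ∈ F ∩ O = 0`. [cite: BertoliniDarmon2005, Lemma 2.6] [cite: WZhang2014, Lemma 5.1]
[cite: MilneADT2006, Ch. I, Cor. 2.3, Thm. 2.8] -/
theorem mem_selmerLocalKer_or_mem_toricLocalKer_of_isotropic (hK : IsImaginaryQuadratic K) (hp2 : p ≠ 2)
    (q : AdmQ W K p) (w : HeightOneSpectrum (𝓞 K)) (hqw : ((q : ℕ) : 𝓞 K) ∈ w.asIdeal)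
    (e : geomTorsion (W.baseChange K) ((p ^ 1 : ℕ) : ℤ) → geomTorsion (W.baseChange K) ((p ^ 1 : ℕ) : ℤ) →
      AlgebraicClosure K)
    (hμ : ∀ P Q, e P Q ^ (p ^ 1) = 1) (hadd₁ : ∀ P₁ P₂ Q, e (P₁ + P₂) Q = e P₁ Q * e P₂ Q)
    (hadd₂ : ∀ P Q₁ Q₂, e P (Q₁ + Q₂) = e P Q₁ * e P Q₂) (halt : ∀ Q, e Q Q = 1)
    (hnondeg : ∀ Q, (∀ P, e P Q = 1) → Q = 0)
    (hgal : ∀ (σ : absoluteGaloisGroup K) (P Q : geomTorsion (W.baseChange K) ((p ^ 1 : ℕ) : ℤ)),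
      σ • e P Q = e (σ • P) (σ • Q))
    (inv : LocalInvariants K (p ^ 1)) (hperf : inv.IsPerfect)
    {x : Vp W K p} (hxK : x ∈ selmerLocalKer (W.baseChange K) (w.adicCompletion K) ((p ^ 1 : ℕ) : ℤ))
    (hx0 : x ∉ (W.baseChange K).torsionLocalKer (w.adicCompletion K) ((p ^ 1 : ℕ) : ℤ))
    {g : Vp W K p}
    (hg : invWeilPairing (W.baseChange K) (p ^ 1) e hμ hadd₁ hadd₂ hgal inv (Sum.inr w)
      (galoisCohomology.localization ((W.baseChange K).torsionGaloisModule ((p ^ 1 : ℕ) : ℤ)) (Sum.inr w) 1 g)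
      (galoisCohomology.localization ((W.baseChange K).torsionGaloisModule ((p ^ 1 : ℕ) : ℤ)) (Sum.inr w) 1 g)
        = 0) :
    g ∈ selmerLocalKer (W.baseChange K) (w.adicCompletion K) ((p ^ 1 : ℕ) : ℤ) ∨
      g ∈ toricLocalKer (W.baseChange K) (w.adicCompletion K) ((p ^ 1 : ℕ) : ℤ) := by
  have hp : p.Prime := Fact.out
  haveI : NeZero (p ^ 1 : ℕ) := ⟨pow_ne_zero 1 hp.ne_zero⟩
  haveI : IsTotallyComplex K := hK.2
  have hK2 : Module.finrank ℚ K = 2 := hK.1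
  have hKc : ∀ u : InfinitePlace K, u.IsComplex := fun u ↦ IsTotallyComplex.isComplex u
  have hp1 : IsPrimePow (p ^ 1 : ℕ) := hp.isPrimePow.pow one_ne_zero
  have hEP : ∀ v : HeightOneSpectrum (𝓞 K), localEulerPoincareCharacteristic (v.adicCompletion K) := fun v ↦ by
    haveI : CharZero (v.adicCompletion K) := charZero_of_injective_algebraMap (algebraMap K _).injective
    exact localEulerPoincareCharacteristic_holds (v.adicCompletion K)
  have hinj : Injective (inv (Sum.inr w)) := (hperf w).1.1
  -- the plane, its pairing, the two lines
  set H := galoisCohomology (((W.baseChange K).torsionGaloisModule ((p ^ 1 : ℕ) : ℤ)).toLocal (Sum.inr w)) 1 with hH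
  set loc := galoisCohomology.localization ((W.baseChange K).torsionGaloisModule ((p ^ 1 : ℕ) : ℤ)) (Sum.inr w) 1
    with hloc
  set b := invWeilPairing (W.baseChange K) (p ^ 1) e hμ hadd₁ hadd₂ hgal inv (Sum.inr w) with hb
  set F : AddSubgroup H := (W.baseChange K).kummerSelmerStructure ((p ^ 1 : ℕ) : ℤ) (Sum.inr w) with hF
  set O : AddSubgroup H := toricLocalCondition (W.baseChange K) (w.adicCompletion K) ((p ^ 1 : ℕ) : ℤ) with hO
  haveI : Finite H := KummerPT.finite_galoisCohomology_toLocal_inr (W.baseChange K) (p ^ 1) w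
  have hA : ∀ y : H, (p ^ 1 : ℕ) • y = 0 := KummerPT.nsmul_galoisCohomology_toLocal_eq_zero (W.baseChange K) (p ^ 1)
    (Sum.inr w)
  have hflip : Bijective b.flip :=
    KummerPT.invWeilPairing_flip_bijective (W.baseChange K) (p ^ 1) e hμ hadd₁ hadd₂ hgal hnondeg inv w hinj
  -- symmetry and isotropies
  have hsymm : ∀ a a' : H, b a a' = b a' a := fun a a' ↦
    invWeilPairing_comm W K p e hμ hadd₁ hadd₂ halt hgal inv (Sum.inr w) a a'
  have hisoF : ∀ a ∈ F, ∀ a' ∈ F, b a a' = 0 := fun a ha a' ha' ↦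
    invWeilPairing_eq_zero_of_mem (W.baseChange K) (p ^ 1) e hμ hadd₁ hadd₂ hgal halt inv (Sum.inr w) ha ha'
  have hisoO : ∀ a ∈ O, ∀ a' ∈ O, b a a' = 0 := fun a ha a' ha' ↦ by
    rw [hb, invWeilPairing_apply, htorIso_toricLocalCondition W K p hK2 q w hqw e hμ hadd₁ hadd₂ halt hgal a ha a' ha']
    exact map_zero _
  -- both lines are Lagrangian
  have hFann : annRight b F = F :=
    KummerDuality.annRight_invWeilPairing_kummerSelmerStructure_eq (W.baseChange K) (p ^ 1) e hμ hadd₁ hadd₂ hgal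
      halt hnondeg inv hKc hp1 hperf hEP (Sum.inr w)
  have hOann : annRight b O = O :=
    annRight_invWeilPairing_eq_of_isotropic_of_card_le (W.baseChange K) (p ^ 1) e hμ hadd₁ hadd₂ hgal hnondeg inv w
      hinj O (fun a ha a' ha' ↦ htorIso_toricLocalCondition W K p hK2 q w hqw e hμ hadd₁ hadd₂ halt hgal a ha a' ha')
      (natCard_galoisCohomology_one_le_mul_natCard_toricLocalCondition W K p hK2 q w hqw)
  -- counts: `#H = p²`, `#F = #O = p`
  have hHcard : Nat.card H = p ^ 2 := by
    obtain ⟨-, hpv⟩ := hasGoodReductionAt_of_isAdmissiblePrime W K q.2 w hqw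
    have hle := natCard_invariants_le_of_admQ W K p hK2 q w hqw
    have hge := le_natCard_invariants_of_admQ W K p hK2 q w hqw
    rw [hH, Nat.pow_one]
    rw [Nat.pow_one] at hle hge
    rw [Int.cast_natCast] at hpv
    rw [natCard_galoisCohomology_one_torsion_eq_sq (W.baseChange K) p w hpv]
    have heq : Nat.card (GaloisRep.restrictField (w.adicCompletion K)
        ((W.baseChange K).torsionGaloisModule (p : ℤ))).toTopRep.ρ.invariants = p := le_antisymm hle hge
    rw [heq]
  have hFcard : Nat.card F = p := by
    have h := natCard_annRight_mul hA b hflip F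
    rw [hFann, hHcard, sq] at h
    exact Nat.mul_self_inj.mp h
  have hOcard : Nat.card O = p := by
    have h := natCard_annRight_mul hA b hflip O
    rw [hOann, hHcard, sq] at h
    exact Nat.mul_self_inj.mp h
  -- the two lines are distinct: `x` is Kummer at `w`, not locally trivial, hence not toric (BD Lemma 2.6)
  have hxF : loc x ∈ F := by
    rw [hF, WeierstrassCurve.kummerSelmerStructure_apply]
    exact (mem_selmerLocalKer_iff_localization_mem_kummer_P W K p w x).mp hxK
  have hFO : F ≠ O := by
    intro hFO
    obtain ⟨hgood, hpv⟩ := hasGoodReductionAt_of_isAdmissiblePrime W K q.2 w hqw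
    obtain ⟨𝔐, h𝔐⟩ := w.localPrimesAbove_nonempty
    have hxO' : loc x ∈ O := by rw [← hFO]; exact hxF
    have hxO : x ∈ toricLocalKer (W.baseChange K) (w.adicCompletion K) ((p ^ 1 : ℕ) : ℤ) :=
      mem_toricLocalKer_of_res_mem_toricLocalCondition (W.baseChange K) (p ^ 1) (w.adicCompletion K) hxO'
    have hpv' : (((p ^ 1 : ℕ) : ℤ) : 𝓞 K) ∉ w.asIdeal := by rw [pow_one]; exact hpv
    exact hx0 (ToricFrob.selmerLocalKer_inf_toricLocalKer_le_torsionLocalKer (W.baseChange K) hgood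
      (pow_ne_zero 1 hp.ne_zero) hpv' h𝔐 (AddSubgroup.mem_inf.mpr ⟨hxK, hxO⟩))
  -- `F ∩ O = 0` and `F + O = H`
  have hinf : F ⊓ O = ⊥ := by
    have hle : F ⊓ O ≤ F := inf_le_left
    have hdvd : Nat.card (F ⊓ O : AddSubgroup H) ∣ p := by
      have h := AddSubgroup.card_dvd_of_le hle
      rwa [hFcard] at h
    rcases (Nat.dvd_prime hp).mp hdvd with h1 | hpc
    · exact AddSubgroup.eq_bot_of_card_eq (F ⊓ O) h1
    · exfalso
      have hFle : F ≤ O := by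
        have heq : F ⊓ O = F := AddSubgroup.eq_of_le_of_card_ge hle (by rw [hFcard, hpc])
        rw [← heq]
        exact inf_le_right
      exact hFO (AddSubgroup.eq_of_le_of_card_ge hFle (by rw [hFcard, hOcard]))
  have hsup : F ⊔ O = ⊤ := by
    have hle : F ≤ F ⊔ O := le_sup_left
    have hdvdH : Nat.card (F ⊔ O : AddSubgroup H) ∣ p ^ 2 := by
      have h := AddSubgroup.card_addSubgroup_dvd_card (F ⊔ O)
      rwa [hHcard] at h
    have hdvdF : p ∣ Nat.card (F ⊔ O : AddSubgroup H) := by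
      have h := AddSubgroup.card_dvd_of_le hle
      rwa [hFcard] at h
    obtain ⟨i, hi, hci⟩ := (Nat.dvd_prime_pow hp).mp hdvdH
    have hne : Nat.card (F ⊔ O : AddSubgroup H) ≠ p := by
      intro hc
      have heq : F = F ⊔ O := AddSubgroup.eq_of_le_of_card_ge hle (by rw [hFcard, hc])
      have hOle : O ≤ F := by
        rw [heq]
        exact le_sup_right
      exact hFO (AddSubgroup.eq_of_le_of_card_ge hOle (by rw [hFcard, hOcard])).symm
    interval_cases i
    · exfalso
      rw [pow_zero] at hci
      rw [hci] at hdvdF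
      exact hp.one_lt.ne' (Nat.dvd_one.mp hdvdF)
    · exact absurd (by rw [hci, pow_one]) hne
    · exact AddSubgroup.eq_top_of_card_eq _ (by rw [hci, hHcard])
  -- decompose `loc g = f + o` and pair
  obtain ⟨f, hf, o, ho, hfo⟩ := AddSubgroup.mem_sup.mp (show loc g ∈ F ⊔ O by rw [hsup]; exact AddSubgroup.mem_top _)
  have h2 : (2 : ZMod (p ^ 1)) * b f o = 0 := by
    have h := hg
    rw [← hfo] at h
    simp only [map_add, AddMonoidHom.add_apply, hisoF f hf f hf, hisoO o ho o ho, hsymm o f, zero_add,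
      add_zero] at h
    rw [two_mul]
    exact h
  have hu : IsUnit (2 : ZMod (p ^ 1)) := by
    rw [pow_one, show (2 : ZMod p) = ((2 : ℕ) : ZMod p) by norm_cast, ZMod.isUnit_iff_coprime]
    exact (Nat.coprime_primes Nat.prime_two hp).mpr (Ne.symm hp2)
  have hbfo : b f o = 0 := (hu.mul_right_eq_zero).mp h2
  by_cases hf0 : f = 0
  · -- `loc g = o` is toric
    right
    refine mem_toricLocalKer_of_res_mem_toricLocalCondition (W.baseChange K) (p ^ 1) (w.adicCompletion K) ?_
    change loc g ∈ O
    rw [← hfo, hf0, zero_add]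
    exact ho
  · -- `f` generates `F`, so `o ∈ F^⊥ = F`, `o ∈ F ∩ O = 0`, `loc g = f` is Kummer
    left
    have hgen : AddSubgroup.zmultiples f = F := zmultiples_eq_of_card_prime F hp hFcard hf hf0
    have hoF : o ∈ F := by
      rw [← hFann, mem_annRight_iff]
      intro f' hf'
      rw [← hgen, AddSubgroup.mem_zmultiples_iff] at hf'
      obtain ⟨k, rfl⟩ := hf'
      rw [map_zsmul, AddMonoidHom.zsmul_apply, hbfo, smul_zero]
    have ho0 : o = 0 := by
      have : o ∈ F ⊓ O := AddSubgroup.mem_inf.mpr ⟨hoF, ho⟩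
      rw [hinf] at this
      exact (AddSubgroup.mem_bot).mp this
    have hgF : loc g ∈ F := by
      rw [← hfo, ho0, add_zero]
      exact hf
    rw [hF, WeierstrassCurve.kummerSelmerStructure_apply] at hgF
    exact (mem_selmerLocalKer_iff_localization_mem_kummer_P W K p w g).mpr hgF

end Summit.BirchSwinnertonDyer.BirchSwinnertonDyer.Theorems.AdditiveKoly

end
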